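import Mathlib
import Summits.ValiantsHypothesis.ValiantsHypothesis.Theses.ValuativeGCT
import Summits.ValiantsHypothesis.ValiantsHypothesis.Theorems.ValuativeGCTValuativeFlipHeadOfPencilCertificate
import Summits.ValiantsHypothesis.ValiantsHypothesis.Theorems.ValuativeGCTValuativeFlipCyclicPencilCertificate

/-!
# `ValuativeGCT.HeadFlip` holds: the linear head of the window flips (slope `6/5`)

Crux `ValuativeGCT.HeadFlip` (stmt-ValiantsHypothesis-15535) — the linear head of the window of the
parent crux `ValuativeGCT.ValuativeFlip` (stmt-ValiantsHypothesis-12624), line `four-row-count`.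

All four head stubs of the line are theorems of the tree:
`stub_fourRowSliceBound` (det-side slice count), `stub_fourRowHilbertLowerBound` (per-side Hilbert
function), `HeadFlip.stub_fourRowBridge` (`GL₄`-equivariant bridge) and — since
`…CyclicPencilCertificate` (wall-breaker k9 gen1 a2, cyclic tridiagonal pencil, `n₀ = 160`) —
`stub_fourRowPencilRank` through its `m`-free form `cyc_pencilCertificate` (hypothesis `H` of
`fourRowPencilRank_of_pencilCertificate`).  The packaging
`headFlip_of_pencilCertificate : H → HeadFlip` (`…HeadOfPencilCertificate`, wall-breaker k5 gen1 s2)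
turns `H` into the route decl.  Hence:

* `headFlipBody_holds` — for all large `n` and every `n ≤ m ≤ (6/5)·n` the body of
  `ValuativeGCT.ValuativeFlip` holds at `(n, m)` (centre `U = ⊥`, `r = 0`, a shape with `≤ 4` rows):
  the first multiplicity obstructions ABOVE the bottom of the window, including `m = n + 1`;
* `HeadFlip_proof : ValuativeGCT.HeadFlip` BY NAME (`a = 6`, `b = 5`).

What remains of `ValuativeFlip` is exactly its tail `TailFlip` (`valuativeFlip_of_tailFlip`,
`…TailSuffices`). [this crux; line four-row-count]
-/

set_option linter.dupNamespace false

namespace Summit.ValiantsHypothesis.ValiantsHypothesis.Theorems.HeadFlip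

open MvPolynomial
open scoped BigOperators Matrix
open Literature.NumberTheory.DiophantineGeometry
open Literature.Computability.AlgebraicComplexity
open Summit.ValiantsHypothesis.ValiantsHypothesis.Theorems.ValuativeFlip

noncomputable section

/-- **The head of the window flips** (body form, slope `6/5`): for all large `n` and every
`n ≤ m`, `5m ≤ 6n`, there are `U = ⊥`, `r = 0`, a degree `δ` and a partition `λ ⊢ mδ` (at most four
rows) with `dim T_⊥(λ) < mult_{λ*} ℂ[Δ_m(X₀₀^{m-n} per_n)]` — verbatim the body of
`ValuativeGCT.ValuativeFlip` / `ValuativeGCT.HeadFlip`.  Unconditional. [this crux] -/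
theorem headFlipBody_holds :
    ∃ n₀ : ℕ, ∀ n ≥ n₀, ∀ (m : ℕ) [NeZero m], n ≤ m → 5 * m ≤ 6 * n →
      ∃ (U : Submodule ℂ (MatIdx m → ℂ)) (r δ : ℕ) (lam : Nat.Partition (m * δ)), (∀ u ∈ U, (Matrix.of fun a b : Fin m => u (toLex (a, b))).rank ≤ r) ∧ lam.parts.card ≤ m * m ∧ (let χ : Weight (MatIdx m) := (Weight.dualOfPartition (m * m) lam).toMatIdx; let T : Submodule ℂ (MvPolynomial (MatIdx m × MatIdx m) ℂ) := MvPolynomial.homogeneousSubmodule (MatIdx m × MatIdx m) ℂ (m * δ) ⊓ ((MvPolynomial.vanishingIdeal ℂ {p : MatIdx m × MatIdx m → ℂ | ∀ j : MatIdx m, (fun i => p (j, i)) ∈ U}) ^ (δ * (m - r))).restrictScalars ℂ ⊓ (⨅ (M : Matrix (MatIdx m) (MatIdx m) ℂ) (_ : linSubst (MatIdx m) ℂ M (detFormLex ℂ m) = detFormLex ℂ m), LinearMap.ker ((MvPolynomial.aeval (R := ℂ) fun p : MatIdx m × MatIdx m => ∑ l : MatIdx m, M l p.2 • MvPolynomial.X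 (p.1, l)).toLinearMap - LinearMap.id (R := ℂ) (M := MvPolynomial (MatIdx m × MatIdx m) ℂ))) ⊓ (⨅ (g : Matrix.GeneralLinearGroup (MatIdx m) ℂ) (_ : IsUpperTriangular g), LinearMap.ker ((MvPolynomial.aeval (R := ℂ) fun p : MatIdx m × MatIdx m => ∑ l : MatIdx m, ((g⁻¹ : Matrix.GeneralLinearGroup (MatIdx m) ℂ) : Matrix (MatIdx m) (MatIdx m) ℂ) p.1 l • MvPolynomial.X (l, p.2)).toLinearMap - weightChar χ g • LinearMap.id (R := ℂ) (M := MvPolynomial (MatIdx m × MatIdx m) ℂ))); Module.finrank ℂ ↥T < orbitMultiplicity ℂ (paddedPerFormLex ℂ n m) m χ) :=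
  headFlipBody_of_pencilCertificate cyc_pencilCertificate

/-- **`ValuativeGCT.HeadFlip` holds** (stmt-ValiantsHypothesis-15535), BY NAME, with slope
`a/b = 6/5`: the cyclic tridiagonal pencil certificate `cyc_pencilCertificate` fed to
`headFlip_of_pencilCertificate`. [this crux] -/
theorem HeadFlip_proof : Summit.ValiantsHypothesis.ValiantsHypothesis.Theses.ValuativeGCT.HeadFlip :=
  headFlip_of_pencilCertificate cyc_pencilCertificate

end

end Summit.ValiantsHypothesis.ValiantsHypothesis.Theorems.HeadFlip
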